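/-
Copyright (c) 2026 the pub-hodgecm-mathlib formalisation cell (harness21).  Prover seat hodgecm-mathlib-K2Liu-p13 (g2), Track B «K2-LIT»,
#184♮ = hLiu418 = `stmt-HodgeConjecture-24832`; Road I v3 organ U1-CT-ind STAGE 2 (Q2), file F5-n (payer of ★ F5-c's binder `hscale`, up to the two scalar moduli).
-/
import Summits.HodgeConjecture.HodgeConjecture.Theorems.K2LiuKlingenInnerSectionLeviLaw      -- ★ F5-c: `upper_rel₁₂₃`, the law's letters
import Summits.HodgeConjecture.HodgeConjecture.Theorems.K2LiuKlingenUnipotentAdelicChart      -- ★ F5-i: `continuous_transport_nKlingen`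
import Mathlib.MeasureTheory.Measure.WithDensity                                           -- `Measure.prod_smul_right`
import Mathlib.MeasureTheory.Measure.Prod
import HarnessLib

/-!
# Crux `HLiu418`, Road I v3, organ U1 stage 2 (Q2), file F5-n: THE SUBSTITUTION MODULUS OF THE KLINGEN-LEVI LAW —
# `∫ g(c q) d(μ_Y × μ_T) = (D_Y·D_T) ∫ g d(μ_Y × μ_T)` for `c = shear ∘ scaling`, from the two scalar moduli BY VALUE (★ F5-c's `hscale` with `δ = D_Y D_T`)

Cell `hodgecm-mathlib`, crux item hLiu418 = `stmt-HodgeConjecture-24832`; squad K2 ∕ K2Liu; LEAD F0P6-plan (g14), co-dealer K2E5-plan (g7); prover K2Liu-p13 (g2).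
THEOREMS ONLY (no `def`, no instance, no notation, no named-fact hypothesis, no `sorry`); lane `--supports stmt-HodgeConjecture-24832 --as helper` (count-neutral).
★ F5-c `klingenInner_levi_law` takes BY VALUE the substitution `c : (y,t) ↦ (a⁻¹σ(a)⁻¹ y + z′σ(t′), a⁻¹ t b₀₀)` and its modulus `hscale : ∫ φ_x(c p) dμ = δ ∫ φ_x dμ`.
On `P = Y × 𝔸_L` (`Y` the skew part, membership law `hY`) with `μ = μ_Y × μ_T`: `c = shear_φ ∘ (s_Y × s_T)`, `s_Y(y) = a⁻¹σ(a⁻¹)·y`, `s_T(t) = a⁻¹ t b₀₀`,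
`φ(t′) = t′σ(b₁₁) b₀₁ σ(t′)` (skew by the unitarity relation `σ(b₁₁)b₀₁ + σ(b₀₁)b₁₁ = 0`; `σ(b₁₁)b₀₀ = 1` turns `t′σ(b₁₁)` back into `a⁻¹t`).
* §1 GENERIC (measurable additive groups `Y, T`, `μ_Y` left invariant, s-finite): `measurePreserving_shear₂` (`(y,t) ↦ (y + φ(t), t)`, Mathlib `skew_product` after a swap),
  **`map_shearScale_eq_smul`** (`(s_Y)_*μ_Y = D_Y μ_Y`, `(s_T)_*μ_T = D_T μ_T` ⇒ `c_*(μ_Y × μ_T) = (D_Y D_T)(μ_Y × μ_T)`; Mathlib `map_prod_map`, `prod_smul_left∕right`),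
  **`integral_comp_shearScale`** (`∫ g ∘ c = (D_Y D_T) ∫ g` for a.e.-strongly measurable `g`).
* §2 KLINGEN (`n = 2`, clause (T1) BY VALUE for continuity): `skew_unit_mul`, `skew_shear`, `fst_klingenSubst`∕`snd_klingenSubst` (★ F5-c's `hcy`, `hct` for THIS `c`), and
  **`klingenInner_hscale`**: `∫ f(Ψξ·Ψ(n_Q((c q).1, 0, (c q).2))·x) d(μ_Y × μ_T) = (D_Y D_T) · ∫ f(Ψξ·Ψ(n_Q(q.1, 0, q.2))·x) d(μ_Y × μ_T)` — ★ F5-c's `hscale` with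
  `δ := D_Y D_T`, from the two scalar moduli `hYs`, `hTs` BY VALUE (idelic absolute values: `= 1` at rational `a, b` by the product formula; in general the `‖a‖`, `‖b₀₀‖`
  powers of the intertwined section — the Literature-level `addHaar_preimage_smul`-type facts, not restated here).
[MoeglinWaldspurger1995, II.1.7], [Weil1965, §39], [Folland1995, §2.2], [GanTakeda2011SiegelWeil, §7.2 p. 23].
HONEST LABEL.  Count-neutral helper: `HC_CM` is proved only modulo the 7 printed citations (2 remaining named inputs: hLiu418 = `stmt-HodgeConjecture-24832`,
h413 = `stmt-HodgeConjecture-24833`) until rung 0 closes.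
-/

set_option autoImplicit false
set_option linter.dupNamespace false -- the mandated namespace repeats `HodgeConjecture.HodgeConjecture`

noncomputable section

open scoped Matrix ENNReal NNReal
open NumberField IsDedekindDomain MeasureTheory MeasureTheory.Measure Function

namespace Summit.HodgeConjecture.HodgeConjecture.Cruxes.HLiu418.K2LiuKlingenInnerSectionModulus

/-! ## §1 Generic: shear ∘ scaling on a product of Haar measures -/

section Generic

variable {Y T : Type*} [AddCommGroup Y] [MeasurableSpace Y] [MeasurableSpace T] [MeasurableAdd₂ Y]
  (μY : Measure Y) (μT : Measure T) [SFinite μY] [SFinite μT] [μY.IsAddLeftInvariant]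

/-- **the shear `(y,t) ↦ (y + φ(t), t)` preserves `μ_Y × μ_T`** (`μ_Y` left invariant; Mathlib `skew_product` over the base `T` after a swap). [cite: Folland1995, §2.2] -/
theorem measurePreserving_shear₂ {φ : T → Y} (hφ : Measurable φ) :
    MeasurePreserving (fun q : Y × T => (q.1 + φ q.2, q.2)) (μY.prod μT) (μY.prod μT) := by
  have h1 : MeasurePreserving (fun q : T × Y => (q.1, q.2 + φ q.1)) (μT.prod μY) (μT.prod μY) := by
    refine MeasurePreserving.skew_product (MeasurePreserving.id μT) (g := fun t y => y + φ t) ?_ (Filter.Eventually.of_forall fun t => ?_)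
    · exact measurable_snd.add (hφ.comp measurable_fst)
    · exact map_add_right_eq_self μY (φ t)
  exact ((measurePreserving_swap (μ := μT) (ν := μY)).comp h1).comp (measurePreserving_swap (μ := μY) (ν := μT))

/-- **`c_*(μ_Y × μ_T) = (D_Y D_T) · (μ_Y × μ_T)`** for `c = shear_φ ∘ (s_Y × s_T)` with `(s_Y)_*μ_Y = D_Y μ_Y`, `(s_T)_*μ_T = D_T μ_T`. [cite: Folland1995, §2.2] [cite: Weil1965, §39] -/
theorem map_shearScale_eq_smul {sY : Y → Y} {sT : T → T} (hsY : Measurable sY) (hsT : Measurable sT) {DY DT : ℝ≥0∞}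
    (hYs : μY.map sY = DY • μY) (hTs : μT.map sT = DT • μT) {φ : T → Y} (hφ : Measurable φ) :
    (μY.prod μT).map (fun q : Y × T => (sY q.1 + φ (sT q.2), sT q.2)) = (DY * DT) • μY.prod μT := by
  have hshear_m : Measurable (fun q : Y × T => (q.1 + φ q.2, q.2)) := (measurable_fst.add (hφ.comp measurable_snd)).prodMk measurable_snd
  have hdecomp : (fun q : Y × T => (sY q.1 + φ (sT q.2), sT q.2)) = (fun q : Y × T => (q.1 + φ q.2, q.2)) ∘ Prod.map sY sT := rfl
  rw [hdecomp, ← Measure.map_map hshear_m (hsY.prodMap hsT), ← Measure.map_prod_map μY μT hsY hsT, hYs, hTs, Measure.prod_smul_left,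
    Measure.prod_smul_right, Measure.map_smul, Measure.map_smul, (measurePreserving_shear₂ μY μT hφ).map_eq, smul_smul]

/-- **`∫ g(c q) d(μ_Y × μ_T) = (D_Y D_T) · ∫ g d(μ_Y × μ_T)`** for a.e.-strongly measurable `g : Y × T → ℂ`. [cite: Folland1995, §2.2] -/
theorem integral_comp_shearScale {sY : Y → Y} {sT : T → T} (hsY : Measurable sY) (hsT : Measurable sT) {DY DT : ℝ≥0∞}
    (hYs : μY.map sY = DY • μY) (hTs : μT.map sT = DT • μT) {φ : T → Y} (hφ : Measurable φ)
    {g : Y × T → ℂ} (hg : AEStronglyMeasurable g (μY.prod μT)) :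
    ∫ q, g (sY q.1 + φ (sT q.2), sT q.2) ∂(μY.prod μT) = ((DY * DT).toReal : ℂ) * ∫ q, g q ∂(μY.prod μT) := by
  have hc : Measurable (fun q : Y × T => (sY q.1 + φ (sT q.2), sT q.2)) :=
    ((hsY.comp measurable_fst).add (hφ.comp (hsT.comp measurable_snd))).prodMk (hsT.comp measurable_snd)
  have hmap := map_shearScale_eq_smul μY μT hsY hsT hYs hTs hφ
  have hg' : AEStronglyMeasurable g ((μY.prod μT).map (fun q : Y × T => (sY q.1 + φ (sT q.2), sT q.2))) := by
    rw [hmap]; exact hg.smul_measure _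
  have h := integral_map hc.aemeasurable hg'
  rw [hmap, integral_smul_measure] at h
  rw [← h, Complex.real_smul]

end Generic

/-! ## §2 The Klingen substitution (`n = 2`): ★ F5-c's `hscale` from the two scalar moduli -/

open Literature.NumberTheory.Automorphic Literature.NumberTheory.Automorphic.UnitaryGroup
open Literature.NumberTheory.GelbartRogawski1991 Literature.NumberTheory.GelbartRogawski1991.GRConstruction
open Literature.NumberTheory.GaloisRepresentations
open Literature.NumberTheory.K2Lit.SiegelDoubled
open Summit.HodgeConjecture.HodgeConjecture.Cruxes.HLiu418.K2LiuDoubledUTwoTwoBorelFrame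
open Summit.HodgeConjecture.HodgeConjecture.Cruxes.HLiu418.K2LiuKlingenParabolicDefs
open Summit.HodgeConjecture.HodgeConjecture.Cruxes.HLiu418.K2LiuKlingenUnipotentDefs
open Summit.HodgeConjecture.HodgeConjecture.Cruxes.HLiu418.K2LiuKlingenUnipotentAdelicDefs
open Summit.HodgeConjecture.HodgeConjecture.Cruxes.HLiu418.K2LiuKlingenUnipotentAdelicChart (continuous_transport_nKlingen)
open Summit.HodgeConjecture.HodgeConjecture.Cruxes.HLiu418.K2LiuKlingenInnerSectionLeviLaw (upper_rel₁ upper_rel₂ upper_rel₃)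
open Summit.HodgeConjecture.HodgeConjecture.Cruxes.HLiu418.K2LiuSiegelDoubledLeviMatrix (conjAdele_conjAdele')
open UnitaryDualPair

section Algebra

variable {R : Type*} [CommRing R] {σ : R →+* R}

/-- `a⁻¹σ(a⁻¹)·y` is skew when `y` is. [cite: Xiong2013, §7 Lemma 7.1] -/
theorem skew_unit_mul (hσ : ∀ x, σ (σ x) = x) (a : Rˣ) {y : R} (hy : σ y = -y) :
    σ (((a⁻¹ : Rˣ) : R) * σ ((a⁻¹ : Rˣ) : R) * y) = -(((a⁻¹ : Rˣ) : R) * σ ((a⁻¹ : Rˣ) : R) * y) := by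
  rw [map_mul, map_mul, hσ, hy]; ring

/-- `t′σ(b₁₁) b₀₁ σ(t′)` is skew for upper-triangular `b ∈ U(J₂)` (`σ(b₁₁)b₀₁ + σ(b₀₁)b₁₁ = 0`). [cite: Rogawski1990, §1.9] -/
theorem skew_shear (hσ : ∀ x, σ (σ x) = x) {b : unitaryGroupOfForm σ ((StdForm.antidiagonal 2).over R)}
    (_hb : ((b : GL (Fin 2) R) : Matrix (Fin 2) (Fin 2) R) 1 0 = 0) (t' : R) :
    σ (t' * σ (((b : GL (Fin 2) R) : Matrix (Fin 2) (Fin 2) R) 1 1) * ((b : GL (Fin 2) R) : Matrix (Fin 2) (Fin 2) R) 0 1 * σ t') =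
      -(t' * σ (((b : GL (Fin 2) R) : Matrix (Fin 2) (Fin 2) R) 1 1) * ((b : GL (Fin 2) R) : Matrix (Fin 2) (Fin 2) R) 0 1 * σ t') := by
  have h4 := (unitaryTwo_entries b).2.2.2
  simp only [map_mul, hσ]
  linear_combination (σ t' * t') * h4

end Algebra

variable {L : Type} [Field L] [NumberField L] [IsCMField L]
variable {N M : ℕ} {e : Fin N × Fin M ≃ Fin 2}
  {dV : Fin N → L} {hdV : ∀ i, IsCMField.complexConj L (dV i) = dV i}
  {dW : Fin M → L} {hdW : ∀ i, IsCMField.complexConj L (dW i) = dW i}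

/-- **the `y`-coordinate of the substitution is ★ F5-c's `hcy`**: `a⁻¹σ(a⁻¹)y + s_T(t)σ(b₁₁)b₀₁σ(s_T(t)) = a⁻¹σ(a⁻¹)y + (a⁻¹ t b₀₁)σ(a⁻¹ t b₀₀)` (`σ(b₁₁)b₀₀ = 1`).
[cite: Xiong2013, §7 Lemma 7.1] -/
theorem fst_klingenSubst (Y : AddSubgroup (AdeleRing (𝓞 L) L)) (hY : ∀ y, y ∈ Y ↔ conjAdele (Fp L) L (IsCMField.complexConj L) y = -y) (a' : (AdeleRing (𝓞 L) L)ˣ)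
    {b : unitaryGroupOfForm (conjAdele (Fp L) L (IsCMField.complexConj L)) ((StdForm.antidiagonal 2).over (AdeleRing (𝓞 L) L))} (hb : ((b : GL (Fin 2) (AdeleRing (𝓞 L) L)) : Matrix (Fin 2) (Fin 2) (AdeleRing (𝓞 L) L)) 1 0 = 0) (q : ↥Y × AdeleRing (𝓞 L) L) :
    ((((fun q : ↥Y × AdeleRing (𝓞 L) L => ((fun y : ↥Y => (⟨((a'⁻¹ : (AdeleRing (𝓞 L) L)ˣ) : AdeleRing (𝓞 L) L) * conjAdele (Fp L) L (IsCMField.complexConj L) ((a'⁻¹ : (AdeleRing (𝓞 L) L)ˣ) : AdeleRing (𝓞 L) L) * (y : AdeleRing (𝓞 L) L), (hY _).2 (skew_unit_mul (conjAdele_conjAdele' L) a' ((hY _).1 y.2))⟩ : ↥Y)) q.1 + (fun t' : AdeleRing (𝓞 L) L => (⟨t' * conjAdele (Fp L) L (IsCMField.complexConj L) (((b : GL (Fin 2) (AdeleRing (𝓞 L) L)) : Matrix (Fin 2) (Fin 2) (AdeleRing (𝓞 L) L)) 1 1) * ((b : GL (Fin 2) (AdeleRing (𝓞 L) L)) : Matrix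 (Fin 2) (Fin 2) (AdeleRing (𝓞 L) L)) 0 1 * conjAdele (Fp L) L (IsCMField.complexConj L) t', (hY _).2 (skew_shear (conjAdele_conjAdele' L) hb t')⟩ : ↥Y)) ((fun t : AdeleRing (𝓞 L) L => ((a'⁻¹ : (AdeleRing (𝓞 L) L)ˣ) : AdeleRing (𝓞 L) L) * t * ((b : GL (Fin 2) (AdeleRing (𝓞 L) L)) : Matrix (Fin 2) (Fin 2) (AdeleRing (𝓞 L) L)) 0 0) q.2), (fun t : AdeleRing (𝓞 L) L => ((a'⁻¹ : (AdeleRing (𝓞 L) L)ˣ) : AdeleRing (𝓞 L) L) * t * ((b : GL (Fin 2) (AdeleRing (𝓞 L) L)) : Matrix (Fin 2) (Fin 2) (AdeleRing (𝓞 L) L)) 0 0) q.2)) q).1 : ↥Y) : AdeleRing (𝓞 L) L) =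
      ((a'⁻¹ : (AdeleRing (𝓞 L) L)ˣ) : AdeleRing (𝓞 L) L) * conjAdele (Fp L) L (IsCMField.complexConj L) ((a'⁻¹ : (AdeleRing (𝓞 L) L)ˣ) : AdeleRing (𝓞 L) L) * (q.1 : AdeleRing (𝓞 L) L) + ((a'⁻¹ : (AdeleRing (𝓞 L) L)ˣ) : AdeleRing (𝓞 L) L) * q.2 * ((b : GL (Fin 2) (AdeleRing (𝓞 L) L)) : Matrix (Fin 2) (Fin 2) (AdeleRing (𝓞 L) L)) 0 1 * conjAdele (Fp L) L (IsCMField.complexConj L) (((a'⁻¹ : (AdeleRing (𝓞 L) L)ˣ) : AdeleRing (𝓞 L) L) * q.2 * ((b : GL (Fin 2) (AdeleRing (𝓞 L) L)) : Matrix (Fin 2) (Fin 2) (AdeleRing (𝓞 L) L)) 0 0) := by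
  have h2 := upper_rel₂ hb
  simp only [AddSubgroup.coe_add, map_mul]
  linear_combination (((a'⁻¹ : (AdeleRing (𝓞 L) L)ˣ) : AdeleRing (𝓞 L) L) * q.2 * ((b : GL (Fin 2) (AdeleRing (𝓞 L) L)) : Matrix (Fin 2) (Fin 2) (AdeleRing (𝓞 L) L)) 0 1 * (conjAdele (Fp L) L (IsCMField.complexConj L) ((a'⁻¹ : (AdeleRing (𝓞 L) L)ˣ) : AdeleRing (𝓞 L) L) * conjAdele (Fp L) L (IsCMField.complexConj L) q.2 * conjAdele (Fp L) L (IsCMField.complexConj L) (((b : GL (Fin 2) (AdeleRing (𝓞 L) L)) : Matrix (Fin 2) (Fin 2) (AdeleRing (𝓞 L) L)) 0 0))) * h2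

/-- the `t`-coordinate of the substitution is ★ F5-c's `hct`. [cite: Xiong2013, §7 Lemma 7.1] -/
theorem snd_klingenSubst (Y : AddSubgroup (AdeleRing (𝓞 L) L)) (hY : ∀ y, y ∈ Y ↔ conjAdele (Fp L) L (IsCMField.complexConj L) y = -y) (a' : (AdeleRing (𝓞 L) L)ˣ)
    {b : unitaryGroupOfForm (conjAdele (Fp L) L (IsCMField.complexConj L)) ((StdForm.antidiagonal 2).over (AdeleRing (𝓞 L) L))} (hb : ((b : GL (Fin 2) (AdeleRing (𝓞 L) L)) : Matrix (Fin 2) (Fin 2) (AdeleRing (𝓞 L) L)) 1 0 = 0) (q : ↥Y × AdeleRing (𝓞 L) L) :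
    ((fun q : ↥Y × AdeleRing (𝓞 L) L => ((fun y : ↥Y => (⟨((a'⁻¹ : (AdeleRing (𝓞 L) L)ˣ) : AdeleRing (𝓞 L) L) * conjAdele (Fp L) L (IsCMField.complexConj L) ((a'⁻¹ : (AdeleRing (𝓞 L) L)ˣ) : AdeleRing (𝓞 L) L) * (y : AdeleRing (𝓞 L) L), (hY _).2 (skew_unit_mul (conjAdele_conjAdele' L) a' ((hY _).1 y.2))⟩ : ↥Y)) q.1 + (fun t' : AdeleRing (𝓞 L) L => (⟨t' * conjAdele (Fp L) L (IsCMField.complexConj L) (((b : GL (Fin 2) (AdeleRing (𝓞 L) L)) : Matrix (Fin 2) (Fin 2) (AdeleRing (𝓞 L) L)) 1 1) * ((b : GL (Fin 2) (AdeleRing (𝓞 L) L)) : Matrix (Fin 2) (Fin 2) (AdeleRing (𝓞 L) L)) 0 1 * conjAdele (Fp L) L (IsCMField.complexConj L) t', (hY _).2 (skew_shear (conjAdele_conjAdele' L) hb t')⟩ : ↥Y)) ((fun t : AdeleRing (𝓞 L) L => ((a'⁻¹ : (AdeleRing (𝓞 L) L)ˣ) : AdeleRing (𝓞 L) L) * t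 * ((b : GL (Fin 2) (AdeleRing (𝓞 L) L)) : Matrix (Fin 2) (Fin 2) (AdeleRing (𝓞 L) L)) 0 0) q.2), (fun t : AdeleRing (𝓞 L) L => ((a'⁻¹ : (AdeleRing (𝓞 L) L)ˣ) : AdeleRing (𝓞 L) L) * t * ((b : GL (Fin 2) (AdeleRing (𝓞 L) L)) : Matrix (Fin 2) (Fin 2) (AdeleRing (𝓞 L) L)) 0 0) q.2)) q).2 = ((a'⁻¹ : (AdeleRing (𝓞 L) L)ˣ) : AdeleRing (𝓞 L) L) * q.2 * ((b : GL (Fin 2) (AdeleRing (𝓞 L) L)) : Matrix (Fin 2) (Fin 2) (AdeleRing (𝓞 L) L)) 0 0 := rfl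

section Transport

variable {SA : GL (Fin (2 + 2)) (AdeleRing (𝓞 L) L)}
  {Ψ : (quasiSplit (Fp L) L (IsCMField.complexConj L) (2 + 2)).Adelic ≃ₜ* HA L e dV hdV dW hdW}
  (hΨ : ∀ g : (quasiSplit (Fp L) L (IsCMField.complexConj L) (2 + 2)).Adelic,
      (((Ψ g : HA L e dV hdV dW hdW) : GL (Fin (2 + 2)) (AdeleRing (𝓞 L) L)) : Matrix (Fin (2 + 2)) (Fin (2 + 2)) (AdeleRing (𝓞 L) L)) =
        (SA : Matrix (Fin (2 + 2)) (Fin (2 + 2)) (AdeleRing (𝓞 L) L)) *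
          ((adelicVal (Fp L) L (IsCMField.complexConj L) (2 + 2) _ g : GL (Fin (2 + 2)) (AdeleRing (𝓞 L) L)) :
            Matrix (Fin (2 + 2)) (Fin (2 + 2)) (AdeleRing (𝓞 L) L)) *
          ((SA⁻¹ : GL (Fin (2 + 2)) (AdeleRing (𝓞 L) L)) : Matrix (Fin (2 + 2)) (Fin (2 + 2)) (AdeleRing (𝓞 L) L)))

include hΨ in
/-- **(Q2) F5-n — ★ F5-c's `hscale` FROM THE TWO SCALAR MODULI.**  `Y ≤ 𝔸_L` the skew part (`hY`), `μ_Y` a left-invariant s-finite measure on `Y`, `μ_T` s-finite on `𝔸_L`,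
`(s_Y)_*μ_Y = D_Y μ_Y` for `s_Y(y) = a⁻¹σ(a⁻¹)y` and `(s_T)_*μ_T = D_T μ_T` for `s_T(t) = a⁻¹ t b₀₀` BY VALUE (`hYs`, `hTs`), `f` continuous; THEN for every `x`
  `∫ f(Ψ(ξ)·Ψ(n_Q((c q).1, 0, (c q).2))·x) d(μ_Y × μ_T) = (D_Y D_T) · ∫ f(Ψ(ξ)·Ψ(n_Q(q.1, 0, q.2))·x) d(μ_Y × μ_T)`
— with `fst_klingenSubst`∕`snd_klingenSubst` this is ★ F5-c `klingenInner_levi_law`'s `hscale` (`P := Y × 𝔸_L`, `yf := (·.1)`, `tf := (·.2)`, `δ := D_Y D_T`).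
[cite: MoeglinWaldspurger1995, II.1.7] [cite: Weil1965, §39] [cite: GanTakeda2011SiegelWeil, §7.2 p. 23] -/
theorem klingenInner_hscale [MeasurableSpace (AdeleRing (𝓞 L) L)] [BorelSpace (AdeleRing (𝓞 L) L)] [SecondCountableTopology (AdeleRing (𝓞 L) L)]
    (Y : AddSubgroup (AdeleRing (𝓞 L) L)) (hY : ∀ y, y ∈ Y ↔ conjAdele (Fp L) L (IsCMField.complexConj L) y = -y)
    (μY : Measure ↥Y) (μT : Measure (AdeleRing (𝓞 L) L)) [SFinite μY] [SFinite μT] [μY.IsAddLeftInvariant]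
    (a' : (AdeleRing (𝓞 L) L)ˣ) {b : unitaryGroupOfForm (conjAdele (Fp L) L (IsCMField.complexConj L)) ((StdForm.antidiagonal 2).over (AdeleRing (𝓞 L) L))} (hb : ((b : GL (Fin 2) (AdeleRing (𝓞 L) L)) : Matrix (Fin 2) (Fin 2) (AdeleRing (𝓞 L) L)) 1 0 = 0)
    {DY DT : ℝ≥0∞} (hYs : μY.map (fun y : ↥Y => (⟨((a'⁻¹ : (AdeleRing (𝓞 L) L)ˣ) : AdeleRing (𝓞 L) L) * conjAdele (Fp L) L (IsCMField.complexConj L) ((a'⁻¹ : (AdeleRing (𝓞 L) L)ˣ) : AdeleRing (𝓞 L) L) * (y : AdeleRing (𝓞 L) L), (hY _).2 (skew_unit_mul (conjAdele_conjAdele' L) a' ((hY _).1 y.2))⟩ : ↥Y)) = DY • μY) (hTs : μT.map (fun t : AdeleRing (𝓞 L) L => ((a'⁻¹ : (AdeleRing (𝓞 L) L)ˣ) : AdeleRing (𝓞 L) L) * t * ((b : GL (Fin 2) (AdeleRing (𝓞 L) L)) : Matrix (Fin 2) (Fin 2) (AdeleRing (𝓞 L) L)) 0 0) = DT • μT)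
    {f : HA L e dV hdV dW hdW → ℂ} (hfc : Continuous f) (x : HA L e dV hdV dW hdW) :
    ∫ q, f (Ψ (jAdelic L 4 (weylXi (AdeleRing (𝓞 L) L) (conjAdele (Fp L) L (IsCMField.complexConj L)))) * Ψ (jAdelic L 4 (nKlingen (AdeleRing (𝓞 L) L) (conjAdele (Fp L) L (IsCMField.complexConj L)) (conjAdele_conjAdele' L) (((((fun q : ↥Y × AdeleRing (𝓞 L) L => ((fun y : ↥Y => (⟨((a'⁻¹ : (AdeleRing (𝓞 L) L)ˣ) : AdeleRing (𝓞 L) L) * conjAdele (Fp L) L (IsCMField.complexConj L) ((a'⁻¹ : (AdeleRing (𝓞 L) L)ˣ) : AdeleRing (𝓞 L) L) * (y : AdeleRing (𝓞 L) L), (hY _).2 (skew_unit_mul (conjAdele_conjAdele' L) a' ((hY _).1 y.2))⟩ : ↥Y)) q.1 + (fun t' : AdeleRing (𝓞 L) L => (⟨t' * conjAdele (Fp L) L (IsCMField.complexConj L) (((b : GL (Fin 2) (AdeleRing (𝓞 L) L)) : Matrix (Fin 2) (Fin 2) (AdeleRing (𝓞 L) L)) 1 1) * ((b : GL (Fin 2)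 (AdeleRing (𝓞 L) L)) : Matrix (Fin 2) (Fin 2) (AdeleRing (𝓞 L) L)) 0 1 * conjAdele (Fp L) L (IsCMField.complexConj L) t', (hY _).2 (skew_shear (conjAdele_conjAdele' L) hb t')⟩ : ↥Y)) ((fun t : AdeleRing (𝓞 L) L => ((a'⁻¹ : (AdeleRing (𝓞 L) L)ˣ) : AdeleRing (𝓞 L) L) * t * ((b : GL (Fin 2) (AdeleRing (𝓞 L) L)) : Matrix (Fin 2) (Fin 2) (AdeleRing (𝓞 L) L)) 0 0) q.2), (fun t : AdeleRing (𝓞 L) L => ((a'⁻¹ : (AdeleRing (𝓞 L) L)ˣ) : AdeleRing (𝓞 L) L) * t * ((b : GL (Fin 2) (AdeleRing (𝓞 L) L)) : Matrix (Fin 2) (Fin 2) (AdeleRing (𝓞 L) L)) 0 0) q.2)) q).1 : ↥Y) : AdeleRing (𝓞 L) L)) ((hY _).1 ((fun q : ↥Y × AdeleRing (𝓞 L) L => ((fun y : ↥Y => (⟨((a'⁻¹ : (AdeleRing (𝓞 L) L)ˣ) : AdeleRing (𝓞 L) L) * conjAdele (Fp L) L (IsCMField.complexConj L) ((a'⁻¹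 : (AdeleRing (𝓞 L) L)ˣ) : AdeleRing (𝓞 L) L) * (y : AdeleRing (𝓞 L) L), (hY _).2 (skew_unit_mul (conjAdele_conjAdele' L) a' ((hY _).1 y.2))⟩ : ↥Y)) q.1 + (fun t' : AdeleRing (𝓞 L) L => (⟨t' * conjAdele (Fp L) L (IsCMField.complexConj L) (((b : GL (Fin 2) (AdeleRing (𝓞 L) L)) : Matrix (Fin 2) (Fin 2) (AdeleRing (𝓞 L) L)) 1 1) * ((b : GL (Fin 2) (AdeleRing (𝓞 L) L)) : Matrix (Fin 2) (Fin 2) (AdeleRing (𝓞 L) L)) 0 1 * conjAdele (Fp L) L (IsCMField.complexConj L) t', (hY _).2 (skew_shear (conjAdele_conjAdele' L) hb t')⟩ : ↥Y)) ((fun t : AdeleRing (𝓞 L) L => ((a'⁻¹ : (AdeleRing (𝓞 L) L)ˣ) : AdeleRing (𝓞 L) L) * t * ((b : GL (Fin 2) (AdeleRing (𝓞 L) L)) : Matrix (Fin 2) (Fin 2) (AdeleRing (𝓞 L) L)) 0 0) q.2), (fun t : AdeleRing (𝓞 L) L => ((a'⁻¹ : (AdeleRing (𝓞 L) L)ˣ)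 : AdeleRing (𝓞 L) L) * t * ((b : GL (Fin 2) (AdeleRing (𝓞 L) L)) : Matrix (Fin 2) (Fin 2) (AdeleRing (𝓞 L) L)) 0 0) q.2)) q).1.2) 0 (((fun q : ↥Y × AdeleRing (𝓞 L) L => ((fun y : ↥Y => (⟨((a'⁻¹ : (AdeleRing (𝓞 L) L)ˣ) : AdeleRing (𝓞 L) L) * conjAdele (Fp L) L (IsCMField.complexConj L) ((a'⁻¹ : (AdeleRing (𝓞 L) L)ˣ) : AdeleRing (𝓞 L) L) * (y : AdeleRing (𝓞 L) L), (hY _).2 (skew_unit_mul (conjAdele_conjAdele' L) a' ((hY _).1 y.2))⟩ : ↥Y)) q.1 + (fun t' : AdeleRing (𝓞 L) L => (⟨t' * conjAdele (Fp L) L (IsCMField.complexConj L) (((b : GL (Fin 2) (AdeleRing (𝓞 L) L)) : Matrix (Fin 2) (Fin 2) (AdeleRing (𝓞 L) L)) 1 1) * ((b : GL (Fin 2) (AdeleRing (𝓞 L) L)) : Matrix (Fin 2) (Fin 2) (AdeleRing (𝓞 L) L)) 0 1 * conjAdele (Fp L) L (IsCMField.complexConj L) t', (hY _).2 (skew_shear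 (conjAdele_conjAdele' L) hb t')⟩ : ↥Y)) ((fun t : AdeleRing (𝓞 L) L => ((a'⁻¹ : (AdeleRing (𝓞 L) L)ˣ) : AdeleRing (𝓞 L) L) * t * ((b : GL (Fin 2) (AdeleRing (𝓞 L) L)) : Matrix (Fin 2) (Fin 2) (AdeleRing (𝓞 L) L)) 0 0) q.2), (fun t : AdeleRing (𝓞 L) L => ((a'⁻¹ : (AdeleRing (𝓞 L) L)ˣ) : AdeleRing (𝓞 L) L) * t * ((b : GL (Fin 2) (AdeleRing (𝓞 L) L)) : Matrix (Fin 2) (Fin 2) (AdeleRing (𝓞 L) L)) 0 0) q.2)) q).2))) * x) ∂(μY.prod μT) =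
      ((DY * DT).toReal : ℂ) * ∫ q, f (Ψ (jAdelic L 4 (weylXi (AdeleRing (𝓞 L) L) (conjAdele (Fp L) L (IsCMField.complexConj L)))) * Ψ (jAdelic L 4 (nKlingen (AdeleRing (𝓞 L) L) (conjAdele (Fp L) L (IsCMField.complexConj L)) (conjAdele_conjAdele' L) (((q.1 : ↥Y) : AdeleRing (𝓞 L) L)) ((hY _).1 q.1.2) 0 (q.2))) * x) ∂(μY.prod μT) := by
  haveI : SecondCountableTopology ↥Y := TopologicalSpace.Subtype.secondCountableTopology (Y : Set (AdeleRing (𝓞 L) L))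
  have hσc := continuous_conjAdele (Fp L) L (IsCMField.complexConj L)
  -- measurability of the three maps
  have hsY : Measurable (fun y : ↥Y => (⟨((a'⁻¹ : (AdeleRing (𝓞 L) L)ˣ) : AdeleRing (𝓞 L) L) * conjAdele (Fp L) L (IsCMField.complexConj L) ((a'⁻¹ : (AdeleRing (𝓞 L) L)ˣ) : AdeleRing (𝓞 L) L) * (y : AdeleRing (𝓞 L) L), (hY _).2 (skew_unit_mul (conjAdele_conjAdele' L) a' ((hY _).1 y.2))⟩ : ↥Y)) :=
    (Continuous.subtype_mk (continuous_const.mul continuous_subtype_val) _).measurable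
  have hsT : Measurable (fun t : AdeleRing (𝓞 L) L => ((a'⁻¹ : (AdeleRing (𝓞 L) L)ˣ) : AdeleRing (𝓞 L) L) * t * ((b : GL (Fin 2) (AdeleRing (𝓞 L) L)) : Matrix (Fin 2) (Fin 2) (AdeleRing (𝓞 L) L)) 0 0) := ((continuous_const.mul continuous_id).mul continuous_const).measurable
  have hφ : Measurable (fun t' : AdeleRing (𝓞 L) L => (⟨t' * conjAdele (Fp L) L (IsCMField.complexConj L) (((b : GL (Fin 2) (AdeleRing (𝓞 L) L)) : Matrix (Fin 2) (Fin 2) (AdeleRing (𝓞 L) L)) 1 1) * ((b : GL (Fin 2) (AdeleRing (𝓞 L) L)) : Matrix (Fin 2) (Fin 2) (AdeleRing (𝓞 L) L)) 0 1 * conjAdele (Fp L) L (IsCMField.complexConj L) t', (hY _).2 (skew_shear (conjAdele_conjAdele' L) hb t')⟩ : ↥Y)) :=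
    (Continuous.subtype_mk (((continuous_id.mul continuous_const).mul continuous_const).mul hσc) _).measurable
  -- the integrand is continuous in `q`
  have hg : Continuous fun q : ↥Y × AdeleRing (𝓞 L) L => f (Ψ (jAdelic L 4 (weylXi (AdeleRing (𝓞 L) L) (conjAdele (Fp L) L (IsCMField.complexConj L)))) * Ψ (jAdelic L 4 (nKlingen (AdeleRing (𝓞 L) L) (conjAdele (Fp L) L (IsCMField.complexConj L)) (conjAdele_conjAdele' L) (((q.1 : ↥Y) : AdeleRing (𝓞 L) L)) ((hY _).1 q.1.2) 0 (q.2))) * x) := by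
    refine hfc.comp ((continuous_const.mul ?_).mul continuous_const)
    exact continuous_transport_nKlingen hΨ (fun q : ↥Y × AdeleRing (𝓞 L) L => (hY _).1 q.1.2) (continuous_subtype_val.comp continuous_fst) continuous_const continuous_snd
  exact integral_comp_shearScale μY μT hsY hsT hYs hTs hφ hg.aestronglyMeasurable

end Transport

end Summit.HodgeConjecture.HodgeConjecture.Cruxes.HLiu418.K2LiuKlingenInnerSectionModulus

end
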